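import Summits.QuantumFields.BalabanUV.T4Continuum.Spine.NE1p.DressedTerminalWitness
import Summits.QuantumFields.BalabanUV.T4Continuum.Spine.NE1p.DressedStabilityOfCanonicalSliceWinSchedules

/-!
# T⁴ programme, spine estimate NE1′ (node O3b/H2) — «A TERMINAL FACE FIRES», part 2: leaf-09-g3's CANONICAL TERMINAL FACE (row
# S3l) BY NAME on the integer-cell datum of part 1 — the row ROOT and ROOT-B at every cutoff from ONE function-level decided datum
# (formalisation crew `b2b-balaban-t4-ne1p-formalise-*`, leaf seat 03, generation 3, witness item W11 «A TERMINAL FACE FIRES»,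
# typer R-T56 (h); own-initiative consistency item, NOT a crew estimate row)

Cell `pub-balaban`, sub-cell `t4`, BINDER-OWNERS row NE1′ (owner lineage t4-ne1p-p1).  ADDITIVE — imports part 1
`Spine/NE1p/DressedTerminalWitness` (the cell at `L = 21`, `κ = 1∕100`, the schedule `W21`, the tower `towerT`, the carried functionals
`FnT`, the binders and the terminal DATA `ancT`∕`compT`∕`ST`∕`βT`, `hneT`∕`hsupT`, `habsT`, …) and leaf-09-g3's row S3l
`Spine/NE1p/DressedStabilityOfCanonicalSliceWinSchedules` (p215128: **`dressedStability_of_canonicalSliceWinSchedules`** ∕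
**`dressedBudget_of_canonicalSliceWinSchedules`** — THE CANONICAL TERMINAL FACE: END-ALL-slice-win ∘ suppliers over the canonical
data; displayed = WALL 8 + `hcm` + dictionary + context + anchoring ∕ absorption ∕ booking-convention DATA + located scalars once)
ONLY; modifies nothing.

WHAT.  **`dressedStability_towerT : DressedStability towerT`** — S3l's ROOT THEOREM BY NAME, EVERY ONE of its ≈ 50 displayed
hypotheses (42 section binders + 8 header binders) inhabited on part 1's datum at the INTEGER blocking factor `21`: the schedule family
`fun _ _ => W21` with `hratioT` (`κ = 1∕100` exactly); the scalars `(κ, L, c̄, N₀, A₀, s̄⁰, ρ′, r, c_δ, m) = (1∕100, 21, 0, 1, 1, ½,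
199∕200, 1, ½, 1∕400)` with `hlocT` ∕ `hsmallT`; the wall families (w1) `hslT`, (w2-act) `realBaseAt_W`∕`exponentSliceAt_M`∕`s ≡ 0`,
(I4′) `hdefwkT`∕`hrateT` (the fresh-pair families vacuous: `Sg ≡ ∅`), (w5) `hregT` + zero constants; the dictionary `FnT_succ`∕
`mem_bddClass_flAt`∕`hQ`∕`hSg`∕`aesm_flAt`; context `hinv`∕`hDμT`∕`hz₁T`; **the terminal DATA**: anchoring `ancT K : Anchoring (BT K) 4 21`
with `hLb : ((21:ℕ):ℝ) = 21` (`norm_num`; the same numeral identity as row W8's `hLb21`), multiplicity `hmultT`, housing `hscaleT`∕`hhousedT`∕`hvolT`, `hvN₀ : 1·1 ≤ 1`; the history-free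
absorption door `Sabs ≡ ∅`, `A = 0`, `habsT`, `hβ` (equality), `hfan`∕`hamp` decided numerals; **the booking convention `hneT` ∕
`hsupT`** (the realised-increment set bounded above and attaining the booked size — `Real.sSup` genuine).  Then ROOT-B
**`dressedBudget_towerT`** by S3l's budget theorem BY NAME (same list + unit run weights, `hv : 1 ≤ 1`).  This closes the referee's
(t5) non-vacuity column for the TERMINAL theorem JOINTLY (until now covered in two halves: W7c function-level at `LW`, W8 booking-level
at `21`) and answers LF-4 constructively: the integer cell `L = 21`, `κ = 1∕100` hosts a function-level datum.

HONEST FRAMING.  A decided toy ([folklore]; 0 sorry; 0 citations; 0 `def`): kernel glue over part 1 and S3l; `𝒜 ≡ 𝒬 ≡ 0`, `Sg ≡ ∅`,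
`s ≡ 0`, `ref = id`, `rel = Eq`, one family, no regeneration (the live corners are rows W7∕W9∕W10∕W12's); `21` is the toy's integer,
never «Bałaban's L»; NOTHING of Bałaban's densities, blocks, components or D-terms is modelled or asserted.  Headline (c4): «the
canonical terminal face FIRES on one function-level decided datum at an integer blocking factor, uniformly in the cutoff — its
entire displayed list is jointly inhabitable; non-vacuity of SHAPES; it changes nothing about the walls; NE1′ ⇐ the named binders,
NOT proved»; spine PROVED 0∕9.  Rung (B)+1 on ONE finite four-torus — NOT infinite volume, NOT a mass gap, NOT OS on ℝ⁴, NOT Clay,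
NOT summit progress.  HONEST DEPENDENCY: continuum YM on T⁴ ⇐ BetaPertH ∧ nine spine estimates (0/9 proved); BetaPertH ⇐ (D1) ∧ (D4) ∧
CAP+tail; G-an2-4 gates asym, D1 and NE2/3/4.

CREDIT ∕ CONTEXT (v1.1, typer R-T59 (ii)).  The located observation that no earlier toy could fire a terminal face is leaf-09-g3's
(CLAIMS.log l.11316, LF-4).  While this item was being built, leaf-07-g5 (l.11470 ∕ l.11541: «W11 is cheap on `towerM` unchanged —
the cell's `L` enters S3l only through the gate guard, the rate-dominated `≤`-binders and the scalars; window `81 ≤ L ≤ 120` at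
`m = ¼`», adopted into LF-4 as the budget-coupled threshold, row S3c.1) and leaf-02-g4 (l.11450 ∕ l.11576: the same reuse route with a
kernel-clean ready file on row W7's `towerM` at `L = 100`, observable coupling LIVE) and leaf-09-g4 (l.11604, an independent scoped
file) worked out the CHEAPER route on row W7's datum.  This file takes the other road — a NEW datum at the LEAST admissible integer
`L = 21` with `κ = 1∕100` and the observable coupling OFF — so the two routes are complementary (integer cell × live `𝒬` is theirs to
file if the typer books it); both are non-vacuity of SHAPES only.
-/

noncomputable section

namespace Summit.QuantumFields.BalabanUV.T4Continuum.NE1p.DressedTerminalWitness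

open MeasureTheory Set Metric Filter Finset
open scoped BigOperators
open Literature.MathematicalPhysics.QuantumFieldTheory.Balaban1983to89
open Literature.MathematicalPhysics.QuantumFieldTheory.Balaban1983to89.T4TermFormat
open Literature.MathematicalPhysics.QuantumFieldTheory.Balaban1983to89.T4TermFormat.Booking
open Literature.MathematicalPhysics.QuantumFieldTheory.Balaban1983to89.T4FeltGeometry
open Literature.MathematicalPhysics.QuantumFieldTheory.Balaban1983to89.T4GatedBooking
open Literature.MathematicalPhysics.QuantumFieldTheory.Balaban1983to89.T4TrajectoryComparison
open T4TrajectoryModulus (bondBall bondBall_add_mem bondBall_latMove_add_mem bondBall_diam)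
open T4BlockTransport (Fld NDir latMove latN Site norm_dir_le)
open T4BirthChartTransport (GaugeInvariant BirthSlice RelGauge)
open T4TrajectoryDensity
open Summit.QuantumFields.BalabanUV.T4Continuum.T4TrajectoryDensityDressed
open Summit.QuantumFields.BalabanUV.T4Continuum.T4TrajectoryDensityWitness
open Summit.QuantumFields.BalabanUV.T4Continuum.NE1p.DressedRoot
open Summit.QuantumFields.BalabanUV.T4Continuum.NE1p.DressedUniformConstants
open Summit.QuantumFields.BalabanUV.T4Continuum.NE1p.DressedWindowScheduleWin
open Summit.QuantumFields.BalabanUV.T4Continuum.NE1p.DressedWindowScheduleModWin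
open Summit.QuantumFields.BalabanUV.T4Continuum.NE1p.DressedTowerWitness
open Summit.QuantumFields.BalabanUV.T4Continuum.NE1p.DressedTowerWitnessSlice (exponentSliceAt_M)
open Summit.QuantumFields.BalabanUV.T4Continuum.NE1p.DressedAbsorptionWindow
open Summit.QuantumFields.BalabanUV.T4Continuum.NE1p.DressedTransportAssembledModSliceWin
open Summit.QuantumFields.BalabanUV.T4Continuum.NE1p.DressedStabilityOfCanonicalSliceWinSchedules

/-! ## §1 Decided numerals of the history-free absorption door at this cell [folklore] -/

/-- [arith] [folklore] `fanout 0 1 (199∕200) = 0 < 1`. -/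
theorem hfanT : fanout 0 1 (199 / 200) < 1 := by unfold fanout; norm_num

/-- [arith] [folklore] `absorbAmplitude 1 0 1 (199∕200) = 1 ≤ A₀ = 1`. -/
theorem hampT : absorbAmplitude 1 0 1 (199 / 200) ≤ 1 := by unfold absorbAmplitude fanout; norm_num

/-! ## §2 THE TERMINAL FACE FIRES: S3l's root and budget theorems BY NAME on the datum [decided toy] -/

/-- **THE CANONICAL TERMINAL FACE FIRES — `DressedStability towerT` BY leaf-09-g3's `dressedStability_of_canonicalSliceWinSchedules`**
[decided toy]: every displayed hypothesis of the terminal face (schedule family + ratio, the K-∕μ-free scalars ONCE with the located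
largeness at the INTEGER `L = 21` and the (w6) window, the wall ∕ dictionary ∕ context families at every `(a, K)`, the anchoring with
`hLb : ((21:ℕ):ℝ) = 21` by `norm_num`, housing, the booking convention with a genuine `sSup`, the history-free absorption door) inhabited by part 1's
ONE function-level datum.  Non-vacuity of the SHAPES of the crew's terminal typed object; nothing of Bałaban's densities. [folklore] -/
theorem dressedStability_towerT : DressedStability towerT :=
  dressedStability_of_canonicalSliceWinSchedules towerT (κ := 1 / 100) (L := 21) (cbar := 0) (N₀ := 1) (A₀ := 1) (sbar := 1 / 2)
    (ρ' := 199 / 200) (r := 1) (cδ := 1 / 2) (m := 1 / 400) (w := fun _ _ => 1) (fun _ _ => W21) (by norm_num)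
    (Fn := fun _ K _ k' k => FnT K k' k) (rel := fun _ _ _ _ _ U U' => U = U') (ref := fun _ _ _ _ U => U)
    (base := fun _ _ _ _ => base₁) (𝒜 := fun _ _ _ _ => zeroExp) (𝒬 := fun _ _ _ _ => zeroExp) (q := fun _ _ _ _ _ => 0)
    (μ := fun _ _ _ k => flAt (atomT k)) (z₀ := fun _ _ _ _ => 0) (z₁ := fun _ _ _ _ => 0) (defect := fun _ _ _ _ k => dT k)
    (s := fun _ _ _ _ => 0) (S := fun _ K => ST K) (Sg := fun _ _ _ _ => ∅) (c := fun _ _ _ _ => (0 : ℂ))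
    (δf := fun _ _ _ _ _ => 0) (creg := fun _ _ _ => 0) (Lb := 21) (mB := 1) (v := 1) (fun _ K => ancT K)
    (comp := fun _ K => compT K) (Sabs := fun _ _ _ => ∅) (β := fun _ K => βT K) (A := 0) (β₀ := 1)
    (fun _ _ => hratioT) (by norm_num) le_rfl zero_le_one zero_le_one (by norm_num) hlocT (by norm_num) hsmallT one_pos
    (by norm_num)
    (fun _ K b k' _ _ _ => birthSlice_anti_window (hslT K b k') (W21.hwcw k'))
    (fun _ K _ k' k _ _ _ _ U => FnT_succ K k' k U) (fun _ _ _ _ k _ _ _ _ _ => mem_bddClass_flAt _ _)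
    (fun _ _ _ _ k _ _ _ _ => realBaseAt_W _ _) (fun _ _ _ _ k _ _ _ _ => exponentSliceAt_M _ _ _ _)
    (fun _ _ _ _ x hx => absurd hx (Finset.notMem_empty x)) (fun _ _ _ k => hDμT k) (fun _ _ _ k => hz₁T k)
    (fun _ _ _ _ _ _ _ x hx => absurd hx (Finset.notMem_empty x)) (fun _ _ _ _ _ _ _ h => h ▸ rfl)
    (fun _ _ _ _ _ k _ => aesm_flAt _ _) (fun _ _ _ _ k => hdefwkT k) (fun _ _ _ k' k _ _ _ => hrateT k' k)
    (fun _ _ _ _ k _ _ _ _ => hneT k) (fun _ K b k' k _ _ _ _ => hsupT K b k' k)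
    (fun _ _ _ => le_rfl) (fun _ _ _ _ => le_rfl) (fun _ K => hregT K _) (fun _ _ _ _ => by norm_num) (by norm_num)
    (fun _ K => hmultT K) (fun _ K => hscaleT K) (fun _ K => hhousedT K) (fun _ K => hvolT K)
    (fun _ _ _ b₀ h => absurd h (Finset.notMem_empty b₀)) (fun _ _ _ => Finset.empty_subset _) (fun _ K => habsT K _)
    (fun _ _ _ _ => le_rfl)
    (fun _ _ _ _ => by funext U z; simp [zeroExp]) (fun _ _ _ _ x hx => absurd hx (Finset.notMem_empty x))
    (fun _ _ _ _ => by simp) (fun _ _ _ _ x hx => absurd hx (Finset.notMem_empty x)) (by norm_num) le_rfl hfanT hampT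

/-- **ROOT-B ON THE SAME DATUM BY THE TERMINAL FACE's BUDGET THEOREM** [decided toy]: `DressedBudget towerT 1` by leaf-09-g3's
`dressedBudget_of_canonicalSliceWinSchedules` BY NAME — the same displayed list, unit run weights, and the bookings' positional count
read off the SAME anchoring (`hv : 1 ≤ v`). [folklore] -/
theorem dressedBudget_towerT : DressedBudget towerT fun _ _ _ => 1 :=
  dressedBudget_of_canonicalSliceWinSchedules towerT (κ := 1 / 100) (L := 21) (cbar := 0) (N₀ := 1) (A₀ := 1) (sbar := 1 / 2)
    (ρ' := 199 / 200) (r := 1) (cδ := 1 / 2) (m := 1 / 400) (w := fun _ _ => 1) (fun _ _ => W21) (by norm_num)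
    (Fn := fun _ K _ k' k => FnT K k' k) (rel := fun _ _ _ _ _ U U' => U = U') (ref := fun _ _ _ _ U => U)
    (base := fun _ _ _ _ => base₁) (𝒜 := fun _ _ _ _ => zeroExp) (𝒬 := fun _ _ _ _ => zeroExp) (q := fun _ _ _ _ _ => 0)
    (μ := fun _ _ _ k => flAt (atomT k)) (z₀ := fun _ _ _ _ => 0) (z₁ := fun _ _ _ _ => 0) (defect := fun _ _ _ _ k => dT k)
    (s := fun _ _ _ _ => 0) (S := fun _ K => ST K) (Sg := fun _ _ _ _ => ∅) (c := fun _ _ _ _ => (0 : ℂ))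
    (δf := fun _ _ _ _ _ => 0) (creg := fun _ _ _ => 0) (Lb := 21) (mB := 1) (v := 1) (fun _ K => ancT K)
    (comp := fun _ K => compT K) (Sabs := fun _ _ _ => ∅) (β := fun _ K => βT K) (A := 0) (β₀ := 1)
    (fun _ _ => hratioT) (by norm_num) le_rfl zero_le_one zero_le_one (by norm_num) hlocT (by norm_num) hsmallT one_pos
    (by norm_num)
    (fun _ K b k' _ _ _ => birthSlice_anti_window (hslT K b k') (W21.hwcw k'))
    (fun _ K _ k' k _ _ _ _ U => FnT_succ K k' k U) (fun _ _ _ _ k _ _ _ _ _ => mem_bddClass_flAt _ _)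
    (fun _ _ _ _ k _ _ _ _ => realBaseAt_W _ _) (fun _ _ _ _ k _ _ _ _ => exponentSliceAt_M _ _ _ _)
    (fun _ _ _ _ x hx => absurd hx (Finset.notMem_empty x)) (fun _ _ _ k => hDμT k) (fun _ _ _ k => hz₁T k)
    (fun _ _ _ _ _ _ _ x hx => absurd hx (Finset.notMem_empty x)) (fun _ _ _ _ _ _ _ h => h ▸ rfl)
    (fun _ _ _ _ _ k _ => aesm_flAt _ _) (fun _ _ _ _ k => hdefwkT k) (fun _ _ _ k' k _ _ _ => hrateT k' k)
    (fun _ _ _ _ k _ _ _ _ => hneT k) (fun _ K b k' k _ _ _ _ => hsupT K b k' k)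
    (fun _ _ _ => le_rfl) (fun _ _ _ _ => le_rfl) (fun _ K => hregT K _) (fun _ _ _ _ => by norm_num) (by norm_num)
    (fun _ K => hmultT K) (fun _ K => hscaleT K) (fun _ K => hhousedT K) (fun _ K => hvolT K)
    (fun _ _ _ b₀ h => absurd h (Finset.notMem_empty b₀)) (fun _ _ _ => Finset.empty_subset _) (fun _ K => habsT K _)
    (fun _ _ _ _ => le_rfl)
    (fun _ _ _ _ => by funext U z; simp [zeroExp]) (fun _ _ _ _ x hx => absurd hx (Finset.notMem_empty x))
    (fun _ _ _ _ => by simp) (fun _ _ _ _ x hx => absurd hx (Finset.notMem_empty x)) (by norm_num) le_rfl hfanT hampT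
    zero_le_one (fun _ _ _ _ => zero_le_one) (fun _ _ _ _ => le_rfl) le_rfl

/-! ## §3 What fired: the class at every cutoff, and the datum is non-degenerate [folklore] -/

/-- [decided toy] From the root: ONE triple of K-∕μ-free constants bounds every booked size of the datum at EVERY cutoff. -/
theorem sizeBound_towerT : ∃ A₀ ρ₁ τ : ℝ, ∀ (p : Unit) (K : ℕ),
    (towerT.B p K).SizeBound (twoRate A₀ ρ₁ τ (towerT.B p K).K) := by
  obtain ⟨A₀, ρ₁, τ, h⟩ := dressedStability_towerT
  exact ⟨A₀, ρ₁, τ, fun p K => sizeBound_of_dressedStabilityWith h p K⟩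

/-- NON-DEGENERACY [folklore]: positive booked sizes and a genuinely acting dressing (`FnT K 0 1 ≠ FnT K 0 0`). -/
theorem towerT_size_pos (K k : ℕ) (b : (BT K).Birth) : 0 < (BT K).size b k := mul_pos (aT_pos K) (dT_pos k)

/-- [folklore] -/
theorem FnT_one_ne_birth (K : ℕ) : FnT K 0 1 ≠ FnT K 0 0 := fun h => by
  have h0 := congrFun h 0
  have ha : (aT K : ℂ) ≠ 0 := by exact_mod_cast (aT_pos K).ne'
  have hs : (0 : ℝ) < αT 0 / 2 := by have := αT_pos 0; positivity
  simp only [FnT, ↓reduceIte, ev₀₀_zero, zero_add, shT] at h0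
  have h1 := mul_left_cancel₀ ha h0
  have h2 : αT 0 / 2 = 0 := by exact_mod_cast h1
  linarith

end Summit.QuantumFields.BalabanUV.T4Continuum.NE1p.DressedTerminalWitness

end
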